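/-
Copyright (c) 2026 the pub-hodgecm-mathlib formalisation cell (harness21).  Prover seat hodgecm-mathlib-K2Liu-p09 (g7): Track B «K2-LIT»,
hLiu418 = stmt-HodgeConjecture-24832; LEAD F0P6-plan RULING M-158d «A7-val road (σ)», small-side socket σ-5: ASK 1 of K2Liu-p10 (g4) (14:19:49Z).
-/
import Summits.HodgeConjecture.HodgeConjecture.Theorems.K2LiuLocalIntertwiningProperty   -- ★ `map_det_blkA_mul_det_blkD` (`σ(det A)·det D = 1`), `prod_invSmulPlace`; ★ `detDelta_levi`, `isUnit_det_blkA_blkD`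
import Summits.HodgeConjecture.HodgeConjecture.Theorems.K2LiuGKRankOneIdentityLFactor     -- ★ `prod_norm_toPlace_eq_sq` (`∏_{w∣v} ‖ι_w y‖_w = ‖y‖_v²`)
import HarnessLib

/-!
# Crux `HLiu418`, road `K2_Liu`, organ A7-val (σ), socket σ-5 ASK 1: `|det D(p)|_v · |det_Δ p|_v = 1` ON THE SIEGEL PARABOLIC `P_Δ(F_v)`

Cell `hodgecm-mathlib`, crux item hLiu418 = `stmt-HodgeConjecture-24832`; squad K2 ∕ K2Liu; prover K2Liu-p09 (g7), organ lead A7-val.  THEOREMS ONLY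
(no `def`, no `instance`, no notation, no named-fact hypothesis, no `sorry`); lane `--supports stmt-HodgeConjecture-24832` (count-neutral helper).
K2Lit currency `(F E c hcδ hδ hd v n hT₀ hT₀d hJD)`; `|x|_v := ∏_{w ∣ v} ‖x_w‖_w` on `E ⊗ F_v = ∏_{w∣v} E_w`.

THE MATHEMATICS ([HarrisKudlaSweet1996, §1 (1.11)–(1.15)]; [Kudla1994, §3]).  For `p ∈ P_Δ(F_v)` with `Δ`-adapted blocks `[[A, B], [0, D]]` (★ `matA`, ★ `blkA`∕`blkD`),
unitarity gives `σ(det A) · det D = 1` in `E ⊗ F_v` (★ `K2LiuLocalIntertwiningProperty.map_det_blkA_mul_det_blkD`), and `det_Δ p_w = (det A)_w` (★ `detDelta_levi`);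
since `c_w : E_{c⁻¹w} → E_w` is an isometry (★ `norm_galAdicCompletionMap`), taking `∏_w ‖·‖_w` and re-indexing along `w ↦ c⁻¹ w` (★ `prod_invSmulPlace`):
* §1 **`prod_norm_det_blkD_mul_absDetDelta`**: `(∏_w ‖(det D(p))_w‖_w) · |det_Δ p|_v = 1` — ASK 1 of K2Liu-p10 (g4): with it the Levi law of the small-side section
  `B = krSection θ_v μ ω` (★ `krSection_levi_mul`, Jacobian `∏_w ‖det D(m)_w‖` by ★ `K2LiuKRFrameLeviJacobian`) carries the character `localSiegelCharacter χ_v (½) m · |det_Δ m|⁻¹ =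
  localSiegelCharacter χ_v (−½) m` (★ `K2LiuA7ValueSocketSiegS.levi_law_shift`, hypothesis `hr`); `absDetDelta_eq_inv_prod_norm_det_blkD`.
* §2 **`one_lt_absDetDelta_of_blkD_eq_smul_one`**: if `D(p) = ι_v(π) · 1` for `π ∈ F_v` with `0 < ‖π‖_v < 1` and `n ≠ 0` then `1 < |det_Δ p|_v` (indeed `|det_Δ p|_v = ‖π‖_v^{−2n}`,
  ★ `prod_norm_toPlace_eq_sq`) — the `ha₀ : absDetDelta (mΔ a₀) ≠ 1` input of ★ `K2LiuA7ValueSocketLevi.hK₁χ_of_laws` once `a₀ ∈ M_Δ` with `D(a₀) = ι_v(ϖ)·1` is chosen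
  (★ `K2LiuLeviDeltaBlockDSurjective.exists_mem_leviDeltaLoc_blkD_eq`; a `π ≠ 0` with `‖π‖_v < 1` is ★ `SemiLocal.exists_norm_lt_one`).
HONEST LABEL.  Count-neutral helper; it retires nothing by itself: `HC_CM` is proved only modulo the 7 printed citations (2 remaining named inputs:
hLiu418 = `stmt-HodgeConjecture-24832`, h413 = `stmt-HodgeConjecture-24833`) until rung 0 closes.

## References
* [HarrisKudlaSweet1996] M. Harris, S. Kudla, W. J. Sweet, *Theta dichotomy for unitary groups*, J. AMS 9 (1996), §1 (1.11)–(1.15) (`P_Δ = M_Δ N_Δ`, `det_Δ`).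
* [Kudla1994] S. Kudla, *Splitting metaplectic covers of dual reductive pairs*, Israel J. Math. 87 (1994), §3 (adapted blocks of the Siegel parabolic).
* [CasselsFrohlichANT1967] J. W. S. Cassels, A. Fröhlich (eds.), *Algebraic Number Theory* (1967), Ch. II §11 (`∏_{w∣v} ‖y‖_w = ‖N y‖_v`).
-/

set_option autoImplicit false
set_option linter.dupNamespace false -- the mandated namespace repeats `HodgeConjecture.HodgeConjecture`

noncomputable section

open NumberField IsDedekindDomain Matrix
open Literature.NumberTheory.Automorphic Literature.NumberTheory.Automorphic.UnitaryGroup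
open Literature.NumberTheory.GelbartRogawski1991.AdaptedBlocks
open Literature.NumberTheory.GelbartRogawski1991.UnitaryDualPair.LocalSplitting
open Literature.NumberTheory.K2Lit.LocalSiegelDoubled
open Summit.HodgeConjecture.HodgeConjecture.Cruxes.HLiu418.K2LiuSiegelLeviWeylAlgebra
open Summit.HodgeConjecture.HodgeConjecture.Cruxes.HLiu418.K2LiuLocalIntertwiningProperty
open Summit.HodgeConjecture.HodgeConjecture.Cruxes.HLiu418.K2LiuGKRankOneIdentityLFactor

namespace Summit.HodgeConjecture.HodgeConjecture.Cruxes.HLiu418.K2LiuSiegelBlockDAbsDetDelta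

variable (F : Type) [Field F] [NumberField F] (E : Type) [Field E] [NumberField E] [Algebra F E]
  [Algebra.IsQuadraticExtension F E] (c : E ≃ₐ[F] E)
  {δ : E} (hcδ : c δ = -δ) (hδ : δ ≠ 0) {d : F} (hd : δ * δ = algebraMap F E d)
  (v : HeightOneSpectrum (𝓞 F)) (n : ℕ) {T₀ : Matrix (Fin n) (Fin n) F} (hT₀ : T₀.IsSymm) (hT₀d : IsUnit T₀.det)
  {JD : Matrix (Fin (n + n)) (Fin (n + n)) E} (hJD : JD = (gramD F n T₀).map (algebraMap F E))

/-! ## §1 `|det D(p)|_v · |det_Δ p|_v = 1` on `P_Δ(F_v)` -/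

omit [Algebra.IsQuadraticExtension F E] in
include hT₀d hJD in
/-- place by place: **`‖(det A(p))_{c⁻¹w}‖ · ‖(det D(p))_w‖ = 1`** for `p` with `C(p) = 0` (the `w`-component of `σ(det A)·det D = 1`, ★ `map_det_blkA_mul_det_blkD`, and the isometry
`c_w : E_{c⁻¹w} → E_w`, ★ `norm_galAdicCompletionMap`). [cite: HarrisKudlaSweet1996, §1 (1.12), (1.15)] [cite: Kudla1994, §3] -/
theorem norm_det_blkA_invSmul_mul_norm_det_blkD {p : UnitaryGroup.localPi E c (n + n) JD v} (hC : blkC (matA F E c v n p) = 0) (w : PlacesOver E v) :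
    ‖(blkA (matA F E c v n p)).det ⟨c⁻¹ • w.1, under_inv_smul_eq c w⟩‖ * ‖(blkD (matA F E c v n p)).det w‖ = 1 := by
  have h := congrFun (map_det_blkA_mul_det_blkD F E c v n hT₀d hJD hC) w
  rw [Pi.mul_apply, Pi.one_apply, conjLocal_apply] at h
  rw [← norm_galAdicCompletionMap c (smul_inv_smul c w.1), ← norm_mul, h, norm_one]

omit [Algebra.IsQuadraticExtension F E] in
include hT₀d hJD in
/-- **ASK 1 (K2Liu-p10 σ-5): `(∏_{w∣v} ‖(det D(p))_w‖_w) · |det_Δ p|_v = 1`** for `p` with `C(p) = 0` (`det_Δ p_w = (det A)_w` ★ `detDelta_levi`; re-indexing `w ↦ c⁻¹ w`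
★ `prod_invSmulPlace`). [cite: HarrisKudlaSweet1996, §1 (1.12), (1.15)] [cite: Kudla1994, §3] -/
theorem prod_norm_det_blkD_mul_absDetDelta_of_blkC {p : UnitaryGroup.localPi E c (n + n) JD v} (hC : blkC (matA F E c v n p) = 0) :
    (∏ w : PlacesOver E v, ‖(blkD (matA F E c v n p)).det w‖) * absDetDelta F E c v n p = 1 := by
  rw [absDetDelta, ← prod_invSmulPlace F E c v (fun w => ‖detDelta F E c v n w p‖), ← Finset.prod_mul_distrib]
  refine Finset.prod_eq_one fun w _ => ?_
  rw [detDelta_levi F E c v n hC, mul_comm]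
  exact norm_det_blkA_invSmul_mul_norm_det_blkD F E c v n hT₀d hJD hC w

include hcδ hδ hd hT₀ hT₀d hJD in
/-- **ASK 1 (K2Liu-p10 σ-5), `IsSiegelDelta` form: `(∏_{w∣v} ‖(det D(p))_w‖_w) · |det_Δ p|_v = 1` on `P_Δ(F_v)`** (★ `isSiegelDelta_iff_blkC_eq_zero`).
[cite: HarrisKudlaSweet1996, §1 (1.12), (1.15)] [cite: Kudla1994, §3] -/
theorem prod_norm_det_blkD_mul_absDetDelta {p : UnitaryGroup.localPi E c (n + n) JD v} (hp : IsSiegelDelta F E c hcδ hδ hd v n hT₀ hJD p) :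
    (∏ w : PlacesOver E v, ‖(blkD (matA F E c v n p)).det w‖) * absDetDelta F E c v n p = 1 :=
  prod_norm_det_blkD_mul_absDetDelta_of_blkC F E c v n hT₀d hJD ((isSiegelDelta_iff_blkC_eq_zero F E c hcδ hδ hd v n hT₀ hJD p).1 hp)

omit [Algebra.IsQuadraticExtension F E] in
include hT₀d hJD in
/-- **`|det_Δ p|_v = (∏_{w∣v} ‖(det D(p))_w‖_w)⁻¹`** for `p` with `C(p) = 0`. [cite: HarrisKudlaSweet1996, §1 (1.12), (1.15)] [cite: Kudla1994, §3] -/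
theorem absDetDelta_eq_inv_prod_norm_det_blkD {p : UnitaryGroup.localPi E c (n + n) JD v} (hC : blkC (matA F E c v n p) = 0) :
    absDetDelta F E c v n p = (∏ w : PlacesOver E v, ‖(blkD (matA F E c v n p)).det w‖)⁻¹ :=
  eq_inv_of_mul_eq_one_right (prod_norm_det_blkD_mul_absDetDelta_of_blkC F E c v n hT₀d hJD hC)

omit [Algebra.IsQuadraticExtension F E] in
include hT₀d hJD in
/-- **`∏_{w∣v} ‖(det D(p))_w‖_w = |det_Δ p|_v⁻¹`** for `p` with `C(p) = 0` — the Jacobian of the small-side Levi law in `|det_Δ|`-currency (K2Liu-p10 σ-5 `hr`).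
[cite: HarrisKudlaSweet1996, §1 (1.12), (1.15)] [cite: Kudla1994, §3] -/
theorem prod_norm_det_blkD_eq_inv_absDetDelta {p : UnitaryGroup.localPi E c (n + n) JD v} (hC : blkC (matA F E c v n p) = 0) :
    (∏ w : PlacesOver E v, ‖(blkD (matA F E c v n p)).det w‖) = (absDetDelta F E c v n p)⁻¹ :=
  eq_inv_of_mul_eq_one_left (prod_norm_det_blkD_mul_absDetDelta_of_blkC F E c v n hT₀d hJD hC)

/-! ## §2 A Levi element with `D = ι_v(π)·1`, `0 < ‖π‖_v < 1`, has `|det_Δ|_v = ‖π‖_v^{-2n} > 1` -/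

omit [Algebra.IsQuadraticExtension F E] in
/-- `(det (ι_v(π) · 1))_w = (ι_w π)^n`. [cite: CasselsFrohlichANT1967, Ch. II §11] -/
theorem det_toLocalRing_smul_one_apply (π : v.adicCompletion F) (w : PlacesOver E v) :
    (toLocalRing E v π • (1 : Matrix (Fin n) (Fin n) (LocalRing E v))).det w = toPlace v w π ^ n := by
  rw [Matrix.det_smul, Matrix.det_one, mul_one, Fintype.card_fin, Pi.pow_apply, toLocalRing_apply]

include hT₀d hJD in
/-- **`|det_Δ p|_v = (‖π‖_v ^ 2)^{-n}`** when `C(p) = 0` and `D(p) = ι_v(π)·1` (★ `prod_norm_toPlace_eq_sq`: `∏_{w∣v} ‖ι_w π‖_w = ‖π‖_v²`).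
[cite: HarrisKudlaSweet1996, §1 (1.15)] [cite: CasselsFrohlichANT1967, Ch. II §11] -/
theorem absDetDelta_eq_of_blkD_eq_smul_one {p : UnitaryGroup.localPi E c (n + n) JD v} (hC : blkC (matA F E c v n p) = 0)
    {π : v.adicCompletion F} (hD : blkD (matA F E c v n p) = toLocalRing E v π • (1 : Matrix (Fin n) (Fin n) (LocalRing E v))) :
    absDetDelta F E c v n p = ((‖π‖ ^ 2) ^ n)⁻¹ := by
  rw [absDetDelta_eq_inv_prod_norm_det_blkD F E c v n hT₀d hJD hC, hD]
  simp_rw [det_toLocalRing_smul_one_apply F E v n π, norm_pow]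
  rw [Finset.prod_pow, prod_norm_toPlace_eq_sq F E v π]

include hT₀d hJD in
/-- **`1 < |det_Δ p|_v`** when `C(p) = 0`, `D(p) = ι_v(π)·1` with `π ≠ 0`, `‖π‖_v < 1`, and `n ≠ 0` — so `|det_Δ p|_v ≠ 1` (the `ha₀` input of ★ `hK₁χ_of_laws`).
[cite: HarrisKudlaSweet1996, §1 (1.15)] [cite: CasselsFrohlichANT1967, Ch. II §11] -/
theorem one_lt_absDetDelta_of_blkD_eq_smul_one {p : UnitaryGroup.localPi E c (n + n) JD v} (hC : blkC (matA F E c v n p) = 0)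
    {π : v.adicCompletion F} (hπ0 : π ≠ 0) (hπ1 : ‖π‖ < 1) (hn : n ≠ 0)
    (hD : blkD (matA F E c v n p) = toLocalRing E v π • (1 : Matrix (Fin n) (Fin n) (LocalRing E v))) :
    1 < absDetDelta F E c v n p := by
  rw [absDetDelta_eq_of_blkD_eq_smul_one F E c v n hT₀d hJD hC hD]
  have h0 : 0 < ‖π‖ ^ 2 := pow_pos (norm_pos_iff.2 hπ0) 2
  have h1 : ‖π‖ ^ 2 < 1 := pow_lt_one₀ (norm_nonneg _) hπ1 two_ne_zero
  exact one_lt_inv_iff₀.2 ⟨pow_pos h0 n, pow_lt_one₀ h0.le h1 hn⟩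

include hT₀d hJD in
/-- **`|det_Δ p|_v ≠ 1`** under the same hypotheses. [cite: HarrisKudlaSweet1996, §1 (1.15)] -/
theorem absDetDelta_ne_one_of_blkD_eq_smul_one {p : UnitaryGroup.localPi E c (n + n) JD v} (hC : blkC (matA F E c v n p) = 0)
    {π : v.adicCompletion F} (hπ0 : π ≠ 0) (hπ1 : ‖π‖ < 1) (hn : n ≠ 0)
    (hD : blkD (matA F E c v n p) = toLocalRing E v π • (1 : Matrix (Fin n) (Fin n) (LocalRing E v))) :
    absDetDelta F E c v n p ≠ 1 :=
  (one_lt_absDetDelta_of_blkD_eq_smul_one F E c v n hT₀d hJD hC hπ0 hπ1 hn hD).ne'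

end Summit.HodgeConjecture.HodgeConjecture.Cruxes.HLiu418.K2LiuSiegelBlockDAbsDetDelta

end
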